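import Mathlib
import Summits.ValiantsHypothesis.ValiantsHypothesis.Theses.GirthSidon
import Summits.ValiantsHypothesis.ValiantsHypothesis.Theorems.GirthSidonMomentExponentsRelationFree
import Summits.ValiantsHypothesis.ValiantsHypothesis.Theorems.GirthSidonMomentCurveElusiveHilbertCount
import Summits.ValiantsHypothesis.ValiantsHypothesis.Theorems.GirthSidonMomentCurveElusiveMonomialNumericToPuiseux

/-!
# GirthSidon — the crux `MomentCurveElusive` in the Hilbert-function regime `s ≲ 6.68 √m`
(partial result on item `stmt-ValiantsHypothesis-6534`, line `registered`; `--supports`, it does not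
close the item, whose regime is `s^10 ≤ m^9`)

The crux asks that the power-sum moment curve `x ↦ (x^{d(m,i)})_{i<m}`,
`d(m,i) = Σ_{k<60} (i+1)^k m^{60k}`, be `(s,2)`-elusive for every `s` with `s^10 ≤ m^9`.  Composing
three tree theorems gives it, unconditionally, for every `s` with `C(s+60, 60) < C(m+29, 30)`
(roughly `s + 60 < 6.68 √m`; e.g. `m = 10^6`: all `s ≤ 6652`) and `m ≥ 60`:

* a pointwise swallower transfers to a formal swallowing `Γ_i(y) = t^{N d(m,i)}` along Laurent series
  (`stub_monomialNumericToPuiseux`: GMOW 2019 Lemma 9.3 + Newton–Puiseux);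
* the Hilbert count inside `V = span(1, y)` (`exists_relation_of_choose_lt`) then produces multisets
  `S ≠ T` of at most `30` indices with `Σ_S N d = Σ_T N d`;
* the B₃₀ property of the power-sum code (`momentExponentsRelationFree_proof`, Vandermonde) forces
  `S = T`.

So below `√m` (times the constant of the count) the route's target holds by dimension counting alone;
the whole difficulty of the crux is the passage from `s ≈ 6.7 √m` to `s = m^{0.9}` (see
`Cruxes/MomentCurveElusive/LEAD-ANALYSIS-c3.md` §1).
-/

-- `Summit.ValiantsHypothesis.ValiantsHypothesis.…` is the tree's mandated single-conjunct layout
-- (Sub = Summit), so the duplicated namespace component is intended.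
set_option linter.dupNamespace false

namespace Summit.ValiantsHypothesis.ValiantsHypothesis.Theorems

/-- **The moment curve is `(s,2)`-elusive in the Hilbert-function regime** (registered helper
`helper_momentCurveSqrt` of item `stmt-ValiantsHypothesis-6534`): for `m ≥ 60` and every `s` with
`C(s + 60, 60) < C(m + 29, 30)` (roughly `s + 60 < 6.68 √m`), the power-sum moment curve
`x ↦ (x^{Σ_{k<60}(i+1)^k m^{60k}})_{i<m}` is `(s,2)`-elusive over `ℂ`: transfer a swallower to a formal
swallowing of `t^{N d}` (`stub_monomialNumericToPuiseux`), extract a relation of length `≤ 30` among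
the `N d(m,i)` by the Hilbert count (`exists_relation_of_choose_lt`), cancel `N`, and contradict the
B₃₀ property of the power-sum code (`momentExponentsRelationFree_proof`).
[cite: Narayanan2026, §2 (proof of Thm. 1); Raz2010, Def. 1.1] -/
theorem helper_momentCurveSqrt : ∀ (m s : ℕ), 60 ≤ m → Nat.choose (s + 60) 60 < Nat.choose (m + 29) 30 → Literature.Computability.AlgebraicComplexity.IsElusive (fun i : Fin m => (MvPolynomial.X 0 : MvPolynomial (Fin 1) ℂ) ^ (∑ k ∈ Finset.range 60, ((i : ℕ) + 1) ^ k * m ^ (60 * k))) s 2 := by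
  intro m s h60 hlt
  by_contra hne
  -- transfer to a formal swallowing of `t^{N d(m,i)}`
  obtain ⟨N, Γ, y, hN, hΓ, hy⟩ := stub_monomialNumericToPuiseux m s
    (fun i : Fin m => ∑ k ∈ Finset.range 60, ((i : ℕ) + 1) ^ k * m ^ (60 * k)) hne
  -- the Hilbert count gives a short relation among the scaled exponents
  obtain ⟨S, T, hST, hS, hT, hsum⟩ := exists_relation_of_choose_lt y
    (fun i : Fin m => N * ∑ k ∈ Finset.range 60, ((i : ℕ) + 1) ^ k * m ^ (60 * k)) Γ hΓ hy hlt
  -- cancel `N`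
  have hsum' : (S.map fun i : Fin m => ∑ k ∈ Finset.range 60, ((i : ℕ) + 1) ^ k * m ^ (60 * k)).sum =
      (T.map fun i : Fin m => ∑ k ∈ Finset.range 60, ((i : ℕ) + 1) ^ k * m ^ (60 * k)).sum := by
    rw [Multiset.sum_map_mul_left, Multiset.sum_map_mul_left] at hsum
    exact Nat.eq_of_mul_eq_mul_left hN hsum
  -- the B₃₀ property of the power-sum code
  exact hST (momentExponentsRelationFree_proof m h60 S T hS hT hsum')

/-- **Corollary in the shape of the crux with the regime made explicit**: there is `m₀` (namely
`60`) such that for all `m ≥ m₀` and all `s` with `C(s+60,60) < C(m+29,30)` the moment curve is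
`(s,2)`-elusive.  (The crux `MomentCurveElusive` asks this for all `s` with `s^10 ≤ m^9`.)
[cite: Narayanan2026, §2 (proof of Thm. 1); Raz2010, Def. 1.1] -/
theorem momentCurveElusive_hilbertRegime :
    ∃ m₀ : ℕ, ∀ m ≥ m₀, ∀ s : ℕ, Nat.choose (s + 60) 60 < Nat.choose (m + 29) 30 →
      Literature.Computability.AlgebraicComplexity.IsElusive
        (fun i : Fin m => (MvPolynomial.X 0 : MvPolynomial (Fin 1) ℂ) ^
          (∑ k ∈ Finset.range 60, ((i : ℕ) + 1) ^ k * m ^ (60 * k))) s 2 :=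
  ⟨60, fun m hm s hs => helper_momentCurveSqrt m s hm hs⟩

end Summit.ValiantsHypothesis.ValiantsHypothesis.Theorems
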